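import Mathlib
import Summits.NavierStokesRegularity.NavierStokesRegularity.Theorems.EulerZoomLiouvillePowerGaugeEulerLiouvilleEnergySaturationOwnRate
import Summits.NavierStokesRegularity.NavierStokesRegularity.Theorems.EulerZoomLiouvillePowerGaugeEulerLiouvilleEnergySaturationScaleODE
import Summits.NavierStokesRegularity.NavierStokesRegularity.Theorems.EulerZoomLiouvillePowerGaugeEulerLiouvilleSelfSimilarSeparablePast
import HarnessLib

/-!
# OWN-RATE SUB-EXTREMAL POWER CLOCKS ARE TRIVIAL — the census form of the power-clock residue `g ∈ [2/5, 1/(2+ρ)]`: a past/shifted collapse of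
# ANY rate `0 < g ≤ ½` whose profile energy dips below its OWN-RATE extremal growth `L^{5−2/g}` vanishes (weak class, no profile hypothesis)
# (crux `EulerZoomLiouville.PowerGaugeEulerLiouville` = stmt-NavierStokesRegularity-19832; line `logtime-breathers`, residue T4 `stub_powerClockRest`)

Route `EulerZoomLiouville` (NavierStokesRegularity); width seat ns-ezl-w6 (cell ns-regularity-ideate, LEAD ns-typeII-p2).  After `…SelfSimilarSlowClockPast`
(`0 < g < 2/5`), `…SelfSimilarSeparablePast` (`g = 0`), ns-ezl-w7's `…SelfSimilarNegClockPast` (`g < 0`), ns-ezl-w4's `…SelfSimilarOffRatePast`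
(`1/(2+ρ) < g < ½`) and `PastShape.…pastFastPowerClock` (`g > ½ − ρ/5`), the past/shifted power clocks of the weak class survive only at the rates
`g ∈ [2/5, 1/(2+ρ)]`, where the scale ODE has the non-decaying own-rate homogeneous solution `L^{5−2/g}`.  This file gives that residue its CENSUS FORM,
the twin of the class-rate two-sided law (`EnergySaturation.ae_eq_zero_of_subExtremal_loc`, Bronzi–Shvydkoy 2015 Thm 1.1):

> **`EnergySaturation.ae_eq_zero_of_ownRate_subExtremal_loc`** (profile level) — class-`ρ` data (A₁), (E₁), (D₁), Poisson, the rate-`g` local energy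
> equality (`0 < g`), and OWN-RATE SUB-EXTREMALITY `liminf_{L→∞} L^{2/g−5}∫_{B_L}|V|² = 0` ⇒ `V = 0` a.e.;
> **`SlowClock.selfSimilar_ae_eq_zero_of_ownRate_subExtremal_past`** (member level) — crux hypotheses verbatim + the representation about `(T, x₀)` for
> `τ < T₁` at ANY rate `0 < g ≤ ½` + own-rate sub-extremality of the velocity profile ⇒ `u = 0` a.e.

So a surviving clock of rate `g ∈ [2/5, 1/(2+ρ)]` SATURATES ITS OWN RATE: `∫_{B_L}|W|² ≥ c₁ L^{5−2/g}` for all large `L`, `c₁ > 0` (in the fictitious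
class `ρ' = 1/g − 2 ∈ [ρ, ½]` it is an extremal class-rate member — the honest residue).  MECHANISM (`…EnergySaturationOwnRate`): the bootstrap FROM THE
LEFT descends the energy exponent from `1 − 2ρ` to the own-rate floor; there `κ + μ < 0` (`κ = 2/g − 5 ≤ 0`... in general whenever the floor is reached),
and the step FROM INFINITY under sub-extremality continues `m ↦ m/2 − 5ρ/4` to a negative exponent; a negative power bound empties every ball.  The DATA
exponent `ρ` and the RATE `g` are decoupled throughout (no re-reading of the gauges in the rate's own class is possible for `g < 1/(2+ρ)`).

WHAT THIS IS NOT: not NS, not E — the dichotomy «vanish or saturate the own rate» for one residue of the crux CLASS 19832 on the MODEL lattice;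
own-rate-EXTREMAL clocks of rates `[2/5, 1/(2+ρ)]` remain OPEN; `--supports` stmt-19832. [folklore; cf. BronziShvydkoy2015 Thm 1.1, ChaeShvydkoy2013 §2.2]
-/

noncomputable section

-- flat `Theorems/<Route><Decl>…` files of one crux share the namespace of the crux (tree convention: `Summit.<S>.<S>.…`)
set_option linter.dupNamespace false

open MeasureTheory Set Filter Topology Metric Function TopologicalSpace
open scoped ENNReal NNReal RealInnerProductSpace ContDiff Laplacian

namespace Summit.NavierStokesRegularity.NavierStokesRegularity.Theorems.PowerGaugeEulerLiouville

open Literature.Analysis Literature.Analysis.FunctionSpaces Literature.Analysis.FluidPDE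

namespace EnergySaturation

variable {ρ g : ℝ}
  {V : EuclideanSpace ℝ (Fin 3) → EuclideanSpace ℝ (Fin 3)} {P : EuclideanSpace ℝ (Fin 3) → ℝ}
  {G : EuclideanSpace ℝ (Fin 3) → EuclideanSpace ℝ (Fin 3) →L[ℝ] EuclideanSpace ℝ (Fin 3)}

/-- **OWN-RATE SUB-EXTREMAL PROFILES ARE TRIVIAL (profile level).**  `(V, P, G)` with the thresholded class data (A₁), (E₁), (D₁) of DATA exponent
`0 < ρ < 1`, the weak Poisson equation, the profile local energy EQUALITY of a collapse of rate `g > 0` (literal shape of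
`ProfileEnergy.profile_local_energy_equality`), and OWN-RATE SUB-EXTREMALITY `∀ ε > 0, ∀ L₀, ∃ L ≥ L₀, L^{2/g−5}∫_{B_L}|V|² < ε`.  Then `V = 0` a.e.
(`g = 1/(2+ρ)` is `ae_eq_zero_of_subExtremal_loc`; `g < 2/5` needs no sub-extremality — `ae_eq_zero_of_slowRate_loc`.) [folklore; cf. BronziShvydkoy2015 Thm 1.1] -/
theorem ae_eq_zero_of_ownRate_subExtremal_loc (hρ : 0 < ρ) (hρ1 : ρ < 1) (hg0 : 0 < g)
    (hVm : AEStronglyMeasurable V volume) (hPm : AEStronglyMeasurable P volume)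
    (hGm : AEStronglyMeasurable G volume)
    (hVG : HasWeakFDerivOn (⊤ : Opens (EuclideanSpace ℝ (Fin 3))) volume V G) {c : ℝ≥0}
    (hA : ∀ L : ℝ, 1 ≤ L → ∫⁻ y in ball (0 : EuclideanSpace ℝ (Fin 3)) L, ‖V y‖ₑ ^ 2 ≤
      (c : ℝ≥0∞) * ENNReal.ofReal (L ^ (1 - 2 * ρ)))
    (hE : ∀ L : ℝ, 1 ≤ L →
      ∫⁻ y in ball (0 : EuclideanSpace ℝ (Fin 3)) L, ENNReal.ofReal (frobeniusNormSq (G y)) ≤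
        ENNReal.ofReal (L ^ (1 - ρ)) * (ENNReal.ofReal ((1 - ρ) / (2 + ρ)) * (c : ℝ≥0∞)))
    (hD : ∀ L : ℝ, 1 ≤ L →
      ∫⁻ y in ball (0 : EuclideanSpace ℝ (Fin 3)) L, ‖P y‖ₑ ^ (3 / 2 : ℝ) ≤
        ENNReal.ofReal (L ^ (2 - 2 * ρ)) * (ENNReal.ofReal ((2 - 2 * ρ) / (2 + ρ)) * (c : ℝ≥0∞)))
    (hPoisson : ∀ θ : EuclideanSpace ℝ (Fin 3) → ℝ, ContDiff ℝ (⊤ : ℕ∞) θ → HasCompactSupport θ →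
      ∫ y, P y * (Δ θ) y = -∫ y, fderiv ℝ (fderiv ℝ θ) y (V y) (V y))
    (hEE : ∀ θ : EuclideanSpace ℝ (Fin 3) → ℝ, IsTestFunctionOn (⊤ : Opens (EuclideanSpace ℝ (Fin 3))) θ →
      (2 - 5 * g) * ∫ x, θ x * ‖V x‖ ^ 2 =
        (∫ x, (‖V x‖ ^ 2 + 2 * P x) * ⟪V x, gradient θ x⟫) +
          g * ∫ x, ‖V x‖ ^ 2 * ⟪x, gradient θ x⟫)
    (hsub : ∀ ε : ℝ, 0 < ε → ∀ L₀ : ℝ, ∃ L : ℝ, L₀ ≤ L ∧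
      L ^ (2 / g - 5) * ∫ y in ball (0 : EuclideanSpace ℝ (Fin 3)) L, ‖V y‖ ^ 2 < ε) :
    V =ᵐ[volume] 0 := by
  have hc0 : (0 : ℝ) ≤ c := c.2
  have hV2 : LocallyIntegrable (fun y => ‖V y‖ ^ 2) volume := locallyIntegrable_norm_sq_of_growth_loc hVm hA
  obtain ⟨σ, hσs, hσc, h0, h1, hone, hzero, -⟩ := exists_radialCutoff
  have hσ : IsTestFunctionOn (⊤ : Opens (EuclideanSpace ℝ (Fin 3))) σ := ⟨hσs, hσc, fun _ _ => trivial⟩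
  set J : ℝ → ℝ := fun R => ∫ y, σ (R⁻¹ • y) * ‖V y‖ ^ 2 with hJ
  set F : ℝ → ℝ := fun r => ∫ x, (‖V x‖ ^ 2 + 2 * P x) * ⟪V x, gradient (fun z => σ (r⁻¹ • z)) x⟫ with hF
  set κ : ℝ := 2 / g - 5 with hκ
  have hJ0 : ∀ R : ℝ, 0 < R → 0 ≤ J R := fun R _ =>
    integral_nonneg fun y => mul_nonneg (h0 _) (sq_nonneg _)
  -- own-rate sub-extremality in cut-off form: `J(L/2) ≤ ∫_{B_L}|V|²`, `(L/2)^κ = 2^{−κ} L^κ`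
  have hsubσ : ∀ ε : ℝ, 0 < ε → ∀ L₀ : ℝ, ∃ L : ℝ, L₀ ≤ L ∧ L ^ (2 / g - 5) * J L < ε := by
    intro ε hε L₀
    have h2κ : 0 < (2 : ℝ) ^ (-κ) := Real.rpow_pos_of_pos two_pos _
    obtain ⟨L', hL', hlt⟩ := hsub (ε / (2 : ℝ) ^ (-κ)) (div_pos hε h2κ) (max (2 * L₀) 2)
    have hL'2 : 2 ≤ L' := (le_max_right _ _).trans hL'
    have hL'0 : 0 < L' := by linarith
    refine ⟨L' / 2, by linarith [(le_max_left _ _).trans hL'], ?_⟩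
    have hB : IntegrableOn (fun y => ‖V y‖ ^ 2) (ball (0 : EuclideanSpace ℝ (Fin 3)) L') volume :=
      (memLp_two_iff_integrable_sq_norm hVm.restrict).1 (memLp_two_ball_of_growth_loc hVm hA _)
    have hle : J (L' / 2) ≤ ∫ y in ball (0 : EuclideanSpace ℝ (Fin 3)) L', ‖V y‖ ^ 2 := by
      simp only [hJ]
      rw [← integral_indicator measurableSet_ball]
      refine integral_mono_of_nonneg (Eventually.of_forall fun y => mul_nonneg (h0 _) (sq_nonneg _))
        (hB.integrable_indicator measurableSet_ball) (Eventually.of_forall fun y => ?_)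
      by_cases hy : y ∈ ball (0 : EuclideanSpace ℝ (Fin 3)) L'
      · rw [indicator_of_mem hy]
        exact mul_le_of_le_one_left (sq_nonneg _) (h1 _)
      · rw [indicator_of_notMem hy]
        rw [mem_ball, dist_zero_right, not_lt] at hy
        have : σ ((L' / 2)⁻¹ • y) = 0 := by
          apply hzero
          rw [norm_smul, norm_inv, Real.norm_of_nonneg (by positivity), le_inv_mul_iff₀ (by positivity)]
          linarith
        show σ ((L' / 2)⁻¹ • y) * ‖V y‖ ^ 2 ≤ 0
        rw [this, zero_mul]
    have hpow : (L' / 2) ^ κ = (2 : ℝ) ^ (-κ) * L' ^ κ := by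
      rw [Real.div_rpow hL'0.le zero_le_two, Real.rpow_neg zero_le_two, div_eq_mul_inv, mul_comm]
    have hI0 : 0 ≤ ∫ y in ball (0 : EuclideanSpace ℝ (Fin 3)) L', ‖V y‖ ^ 2 :=
      setIntegral_nonneg measurableSet_ball fun y _ => sq_nonneg _
    calc (L' / 2) ^ (2 / g - 5) * J (L' / 2) = (2 : ℝ) ^ (-κ) * (L' ^ κ * J (L' / 2)) := by
          rw [← hκ, hpow]; ring
      _ ≤ (2 : ℝ) ^ (-κ) * (L' ^ κ * ∫ y in ball (0 : EuclideanSpace ℝ (Fin 3)) L', ‖V y‖ ^ 2) :=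
          mul_le_mul_of_nonneg_left (mul_le_mul_of_nonneg_left hle (Real.rpow_nonneg hL'0.le _)) h2κ.le
      _ < (2 : ℝ) ^ (-κ) * (ε / (2 : ℝ) ^ (-κ)) := by rw [hκ]; exact mul_lt_mul_of_pos_left hlt h2κ
      _ = ε := mul_div_cancel₀ ε h2κ.ne'
  -- ### a NEGATIVE power bound on `J` at large scales
  have hpowb : ∃ m C L₁ : ℝ, m < 0 ∧ 0 ≤ C ∧ 1 ≤ L₁ ∧ ∀ R : ℝ, L₁ ≤ R → J R ≤ C * R ^ m := by
    by_cases hc : (c : ℝ) = 0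
    · refine ⟨-1, 0, 1, by norm_num, le_rfl, le_rfl, fun R hR => ?_⟩
      have hR0 : 0 < R := lt_of_lt_of_le one_pos hR
      have h := normEnergy_le_of_growth_loc (ρ := ρ) h0 h1 hzero hVm hA hR
      rw [hc, mul_zero] at h
      have hRp : 0 < R ^ (2 * ρ - 1) := Real.rpow_pos_of_pos hR0 _
      have hJle : J R ≤ 0 := by
        have : R ^ (2 * ρ - 1) * J R ≤ R ^ (2 * ρ - 1) * 0 := by rw [mul_zero]; exact h
        exact le_of_mul_le_mul_left this hRp
      simpa using hJle
    have hcpos : 0 < (c : ℝ) := lt_of_le_of_ne hc0 (Ne.symm hc)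
    have hEEσ : ∀ L : ℝ, 0 < L → (2 - 5 * g) * ∫ x, σ (L⁻¹ • x) * ‖V x‖ ^ 2 =
        (∫ x, (‖V x‖ ^ 2 + 2 * P x) * ⟪V x, gradient (fun z => σ (L⁻¹ • z)) x⟫) +
          g * ∫ x, ‖V x‖ ^ 2 * ⟪x, gradient (fun z => σ (L⁻¹ • z)) x⟫ :=
      fun L hL => hEE _ (isTestFunctionOn_comp_inv_smul hσ hL.ne')
    have hderiv : ∀ r : ℝ, 0 < r →
        HasDerivAt (fun L : ℝ => L ^ (2 / g - 5) * J L) (g⁻¹ * r ^ (2 / g - 6) * F r) r :=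
      fun r hr => hasDerivAt_rpowMul_cutoffEnergy_of_energyEquality hg0.ne' hσ hVm hV2 hr (hEEσ r hr)
    obtain ⟨A, hA0, hfluxW⟩ := exists_fluxWeight_le_of_sup_loc hρ hρ1 hσ h0 h1 hone hzero hVm hPm hGm hVG hA hE hD
      hPoisson
    have hflux : ∀ S : ℝ, 0 ≤ S → S ≤ 3 * c → ∀ L : ℝ, 1 ≤ L →
        (∀ R : ℝ, L ≤ R → J R ≤ R ^ (1 - 2 * ρ) * S) →
        ∀ r : ℝ, L ≤ r → |(2 + ρ) * r ^ (2 * ρ - 2) * F r| ≤ A * S ^ (1 / 2 : ℝ) * r ^ (-1 - (2 + ρ) / 4) :=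
      fun S hS hS3 L hL hsup r hr => hfluxW S hS hS3 L hL hsup r hr
    set C₀ : ℝ := (3 : ℝ) ^ (1 - 2 * ρ) * c with hC₀
    have hC₀0 : 0 ≤ C₀ := by rw [hC₀]; positivity
    have hC₀3 : C₀ ≤ 3 * c := by
      have h3 : (3 : ℝ) ^ (1 - 2 * ρ) ≤ 3 := by
        conv_rhs => rw [← Real.rpow_one 3]
        exact Real.rpow_le_rpow_of_exponent_le (by norm_num) (by linarith)
      rw [hC₀]; gcongr
    have hbase : ∀ R : ℝ, 1 ≤ R → J R ≤ C₀ * R ^ (1 - 2 * ρ) := by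
      intro R hR
      have hR0 : 0 < R := lt_of_lt_of_le one_pos hR
      have h := normEnergy_le_of_growth_loc (ρ := ρ) h0 h1 hzero hVm hA hR
      have hRR : R ^ (1 - 2 * ρ) * R ^ (2 * ρ - 1) = 1 := by rw [← Real.rpow_add hR0]; norm_num
      calc J R = R ^ (1 - 2 * ρ) * (R ^ (2 * ρ - 1) * J R) := by rw [← mul_assoc, hRR, one_mul]
        _ ≤ R ^ (1 - 2 * ρ) * ((3 : ℝ) ^ (1 - 2 * ρ) * c) :=
            mul_le_mul_of_nonneg_left h (Real.rpow_nonneg hR0.le _)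
        _ = C₀ * R ^ (1 - 2 * ρ) := by rw [hC₀]; ring
    exact ownRate_iterate hρ hg0 hcpos hA0 hJ0 hflux hderiv hsubσ hC₀0 hC₀3 hbase
  obtain ⟨m, C, L₁, hm, hC, hL₁, hb⟩ := hpowb
  -- ### CONCLUSION: the energy of every ball vanishes
  have hballzero : ∀ L₀ : ℝ, 0 < L₀ → ∫⁻ y in ball (0 : EuclideanSpace ℝ (Fin 3)) L₀, ‖V y‖ₑ ^ 2 = 0 := by
    intro L₀ hL₀
    refine le_antisymm (ENNReal.le_of_forall_pos_le_add fun δ hδ _ => ?_) zero_le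
    rw [zero_add]
    have htend : Tendsto (fun L : ℝ => C * L ^ m) atTop (𝓝 (C * 0)) := by
      refine tendsto_const_nhds.mul ?_
      have := tendsto_rpow_neg_atTop (y := -m) (by linarith)
      simpa using this
    rw [mul_zero] at htend
    have hev := (htend.eventually (gt_mem_nhds (show (0 : ℝ) < δ from hδ))).and
      (eventually_ge_atTop (max L₀ L₁))
    obtain ⟨L, hLδ, hLge⟩ := hev.exists
    have hLL₁ : L₁ ≤ L := (le_max_right _ _).trans hLge
    have hL0 : 0 < L := lt_of_lt_of_le (lt_of_lt_of_le one_pos hL₁) hLL₁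
    have hLL₀ : L₀ ≤ L := (le_max_left _ _).trans hLge
    have h1' := lintegral_ball_sq_le_cutoffEnergy hσs.continuous hσc h0 hone hV2 hL0
    calc ∫⁻ y in ball (0 : EuclideanSpace ℝ (Fin 3)) L₀, ‖V y‖ₑ ^ 2
        ≤ ∫⁻ y in ball (0 : EuclideanSpace ℝ (Fin 3)) L, ‖V y‖ₑ ^ 2 := lintegral_mono_set (ball_subset_ball hLL₀)
      _ ≤ ENNReal.ofReal (J L) := h1'
      _ ≤ ENNReal.ofReal (C * L ^ m) := ENNReal.ofReal_le_ofReal (hb L hLL₁)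
      _ ≤ (δ : ℝ≥0∞) := by
          rw [← ENNReal.ofReal_coe_nnreal]; exact ENNReal.ofReal_le_ofReal hLδ.le
  have hball_ae : ∀ n : ℕ, ∀ᵐ y ∂(volume.restrict (ball (0 : EuclideanSpace ℝ (Fin 3)) ((n : ℝ) + 1))), V y = 0 := by
    intro n
    have h := hballzero ((n : ℝ) + 1) (by positivity)
    rw [lintegral_eq_zero_iff' (hVm.restrict.enorm.pow_const 2)] at h
    filter_upwards [h] with y hy
    simpa using hy
  have hunion : (⋃ n : ℕ, ball (0 : EuclideanSpace ℝ (Fin 3)) ((n : ℝ) + 1)) = univ := by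
    refine eq_univ_of_forall fun y => mem_iUnion.2 ?_
    obtain ⟨n, hn⟩ := exists_nat_gt ‖y‖
    exact ⟨n, by rw [mem_ball, dist_zero_right]; linarith⟩
  have h := (ae_restrict_iUnion_iff (μ := (volume : Measure (EuclideanSpace ℝ (Fin 3))))
    (fun n : ℕ => ball (0 : EuclideanSpace ℝ (Fin 3)) ((n : ℝ) + 1)) (fun y => V y = 0)).2 hball_ae
  rw [hunion, Measure.restrict_univ] at h
  exact h

end EnergySaturation

namespace SlowClock

variable {ρ g T T₁ : ℝ} {x₀ : EuclideanSpace ℝ (Fin 3)}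
  {u : ℝ → EuclideanSpace ℝ (Fin 3) → EuclideanSpace ℝ (Fin 3)} {p : ℝ → EuclideanSpace ℝ (Fin 3) → ℝ}
  {H : ℝ → EuclideanSpace ℝ (Fin 3) → EuclideanSpace ℝ (Fin 3) →L[ℝ] EuclideanSpace ℝ (Fin 3)} {c : ℝ≥0}
  {W : EuclideanSpace ℝ (Fin 3) → EuclideanSpace ℝ (Fin 3)} {P : EuclideanSpace ℝ (Fin 3) → ℝ}

/-- **OWN-RATE SUB-EXTREMAL POWER CLOCKS ARE TRIVIAL (member level).**  Crux hypotheses verbatim (`0 < ρ ≤ ½`, weak class) + exact self-similarity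
of `(u, p)` about `(T, x₀)` at ANY rate `0 < g ≤ ½` FOR `τ < T₁` ONLY (`T₁ ≤ 0`, `T₁ ≤ T`) + OWN-RATE SUB-EXTREMALITY of the velocity profile,
`∀ ε > 0, ∀ L₀, ∃ L ≥ L₀, L^{2/g−5}∫_{B_L}|W|² < ε` ⇒ `u = 0` a.e. on `(−∞,0) × ℝ³`.  For the residual rates `g ∈ [2/5, 1/(2+ρ)]` this is the census
statement: a surviving clock SATURATES its own rate, `∫_{B_L}|W|² ≥ c₁L^{5−2/g}` for all large `L`. [folklore; cf. BronziShvydkoy2015 Thm 1.1] -/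
theorem selfSimilar_ae_eq_zero_of_ownRate_subExtremal_past (hρ : 0 < ρ) (hρh : ρ ≤ 1 / 2) (hT₁ : T₁ ≤ 0) (hTT₁ : T₁ ≤ T)
    (x₀ : EuclideanSpace ℝ (Fin 3))
    (hsw : IsSuitableWeakSolutionOn (slab (EuclideanSpace ℝ (Fin 3)) (Iio 0) isOpen_Iio) 0 0 u p)
    (hH : HasWeakSpatialGradientOn (slab (EuclideanSpace ℝ (Fin 3)) (Iio 0) isOpen_Iio) u H)
    (hgauge : ∀ a : ℝ, 0 < a →
      ENNReal.ofReal (a ^ (2 * ρ)) * cknA a (0 : ℝ × EuclideanSpace ℝ (Fin 3)) u +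
          ENNReal.ofReal (a ^ ρ) * cknE a (0 : ℝ × EuclideanSpace ℝ (Fin 3)) H +
        ENNReal.ofReal (a ^ (2 * ρ)) * cknD a (0 : ℝ × EuclideanSpace ℝ (Fin 3)) p ≤ (c : ℝ≥0∞))
    (hg0 : 0 < g) (hg2 : 2 * g ≤ 1)
    (hu : ∀ τ : ℝ, τ < T₁ → u τ = fun x => selfSimilarCollapse g T W τ (x - x₀))
    (hp : ∀ τ : ℝ, τ < T₁ → p τ = fun x => selfSimilarCollapsePressure g T P τ (x - x₀))
    (hsub : ∀ ε : ℝ, 0 < ε → ∀ L₀ : ℝ, ∃ L : ℝ, L₀ ≤ L ∧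
      L ^ (2 / g - 5) * ∫ y in ball (0 : EuclideanSpace ℝ (Fin 3)) L, ‖W y‖ ^ 2 < ε) :
    uncurry u =ᵐ[volume.restrict (Iio (0 : ℝ) ×ˢ (univ : Set (EuclideanSpace ℝ (Fin 3))))] 0 := by
  have hρ1 : ρ < 1 := by linarith
  obtain ⟨G, c', hWm, hPm, hGm, hWG, hA₁, hE₁, hD₁, hPoisson, hEE⟩ :=
    exists_locData_past_rate hρ hρh hT₁ hTT₁ x₀ hsw hH hgauge hg0.le hg2 hu hp
  have hW0 : W =ᵐ[volume] 0 :=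
    EnergySaturation.ae_eq_zero_of_ownRate_subExtremal_loc hρ hρ1 hg0 hWm hPm hGm hWG hA₁ hE₁ hD₁ hPoisson hEE hsub
  exact Past.ae_eq_zero_of_profile_ae_eq_zero hρ.le hTT₁ hsw hH hgauge hu hW0

end SlowClock

end Summit.NavierStokesRegularity.NavierStokesRegularity.Theorems.PowerGaugeEulerLiouville

end
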